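import Summits.NavierStokesRegularity.FluidComputer.PalasekTowerGermHostAt
import Summits.NavierStokesRegularity.FluidComputer.PalasekTowerGermHostTameCarrier

/-!
# The TAME CARRIER AT ARBITRARY RATES `R`: the strict slot `LevelZeroDataAt R` is filled by
# `Y₀(R) • B_a + λ (Y₀(R)/Y₀(wide)) • farPusher` — layer L3 of the door port

Cell `ns-blowup`, seat `ns-blowup-ecbridge-3` (g8); GROUP C «BRIDGE SUPPORT» of the route
`PalasekTowerBreakdown` after the RE-BASE (rev 19; live crux `EpisodeBaseT := EpisodeBaseGAt TowerRates.tuned`,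
stmt-NavierStokesRegularity-20303). The `R`-generic twin of `PalasekTowerTinyHosts` §2 (ecbridge-4) and of
`PalasekTowerGermHostStrictTiny` / `PalasekTowerGermHostTameCarrier` (this lineage): the SAME blob `B_a`, the
SAME pusher potential, rescaled to the speed `Y₀(R)` of the rates record, with an `N₀(R)`-generic winding
number for the core loop. LABEL: E–C typing (KERNEL construction: three definitions with body — the blob
profile at `R`, the winding number at `R`, the tame carrier at `R` — and their calculus; everything proved).
WHAT THIS IS NOT: not Navier–Stokes evidence — one explicit family of compactly supported divergence-free
profiles passing the LEVEL-`0` READOUTS and the STRICT ANCHOR TEST of the register at the rates `R` at one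
instant; nothing about its evolution (sequel `…TameCarrierAtRun`), any crux, `RungG 1` or blow-up.

* §1 `tinyProfileAt R a = Y₀(R) • B_a`: smooth, divergence free, supported in `B̄(0, 2a)`, even, flat at the
  centre, `‖·‖ ≤ Y₀(R)` with equality exactly at `0`; strain floor `A₀(R) = N₀(R) Y₀(R)` at `a • strainPt`
  once `a ≤ strainConst/N₀(R)`; the `N₀(R)`-core loop `tinyLoop a m`, `m = windingsAt R a = ⌈3/(N₀ a)⌉`
  (radius `a/5 ≤ 1/N₀`, speed `2πma/5 ≤ 8π/N₀`, circulation `≥ Y₀ (7/20) a m ≥ Y₀/N₀ = N₀^{β−2}`) once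
  `a ≤ 5/N₀(R)`;
* §2 the pusher at `R` is `faintPusher μ`, `μ = λ Y₀(R)/Y₀(wide)` (so `‖·‖ ≤ |λ|(15/32)Y₀(R)`), orthogonal
  to `Y₀(R) e₃`, in the forward cone;
* §3 **`tameCarrierAt R a λ = tinyProfileAt R a + faintPusher (λ Y₀(R)/Y₀(wide))`** and
  **`levelZeroDataAt_tameCarrierAt`**: `LevelZeroDataAt R (tameCarrierAt R a λ) 7` for
  `0 < a ≤ min (5/256) (5/N₀(R)) ⊓ strainConst/N₀(R)`, `0 < λ ≤ 1` (anchor by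
  `inner_accel_pos_of_flat_forward`, value `∝ μ² > 0`).

References: S. Palasek, arXiv:2605.13827 §3.3 [cite: Palasek2026ElementaryModel, §3.3]; A. J. Majda,
A. L. Bertozzi, *Vorticity and Incompressible Flow* (CUP 2002), §1.8 Prop. 1.16 [cite: MajdaBertozziCUP2002, §1.8 Prop. 1.16].
-/

noncomputable section

namespace Summit.NavierStokesRegularity.FluidComputer.PalasekTowerClayBridge.Germ

open Set Function Filter Topology InnerProductSpace Metric MeasureTheory Real
open scoped Topology ContDiff RealInnerProductSpace ENNReal Laplacian

open Literature.Analysis.FluidPDE TinyBlob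

variable {R : TowerRates} {a lam : ℝ}

/-! ## §1 The blob profile at the rates `R` -/

/-- **The blob profile at the rates `R`**: `U_a = Y₀(R) • B_a`. [folklore] -/
def tinyProfileAt (R : TowerRates) (a : ℝ) (y : EuclideanSpace ℝ (Fin 3)) : EuclideanSpace ℝ (Fin 3) :=
  R.Y 0 • tinyBlob a y

/-- `A₀ = N₀ Y₀` for every rates record (`A = N^β`, `Y = N^{β−1}`). [folklore] -/
theorem A_zero_eq_N_mul_Y (R : TowerRates) : R.A 0 = R.N 0 * R.Y 0 := by
  show R.N 0 ^ R.β = R.N 0 * R.N 0 ^ (R.β - 1)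
  have hN : R.N 0 ≠ 0 := (R.N_pos 0).ne'
  conv_lhs => rw [show R.β = (R.β - 1) + 1 by ring]
  rw [Real.rpow_add_one hN, mul_comm]

/-- `N₀^{β−2} = Y₀/N₀` for every rates record. [folklore] -/
theorem rpow_β_sub_two_eq (R : TowerRates) : R.N 0 ^ (R.β - 2) = R.Y 0 / R.N 0 := by
  show _ = R.N 0 ^ (R.β - 1) / R.N 0
  have hN : R.N 0 ≠ 0 := (R.N_pos 0).ne'
  rw [show R.β - 2 = (R.β - 1) - 1 by ring, Real.rpow_sub_one hN]

/-- `U_a` is smooth. [folklore] -/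
theorem contDiff_tinyProfileAt (R : TowerRates) (a : ℝ) : ContDiff ℝ ∞ (tinyProfileAt R a) := by
  show ContDiff ℝ ∞ (fun y => R.Y 0 • tinyBlob a y)
  exact (contDiff_const (c := R.Y 0)).smul (contDiff_tinyBlob a)

/-- `U_a` vanishes outside `B̄(0, 2a)`. [folklore] -/
theorem tinyProfileAt_eq_zero_of_norm_gt (ha : 0 < a) {y : EuclideanSpace ℝ (Fin 3)} (hy : 2 * a < ‖y‖) :
    tinyProfileAt R a y = 0 := by
  rw [tinyProfileAt, tinyBlob_eq_zero_of_norm_gt ha hy, smul_zero]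

/-- `tsupport U_a ⊆ B̄(0, 2a)`. [folklore] -/
theorem tsupport_tinyProfileAt_subset (ha : 0 < a) :
    tsupport (tinyProfileAt R a) ⊆ closedBall (0 : EuclideanSpace ℝ (Fin 3)) (2 * a) :=
  (tsupport_smul_subset_right (fun _ => R.Y 0) (tinyBlob a)).trans (tsupport_tinyBlob_subset ha)

/-- `U_a` has compact support. [folklore] -/
theorem hasCompactSupport_tinyProfileAt (ha : 0 < a) : HasCompactSupport (tinyProfileAt R a) :=
  (isCompact_closedBall (0 : EuclideanSpace ℝ (Fin 3)) (2 * a)).of_isClosed_subset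
    (isClosed_tsupport _) (tsupport_tinyProfileAt_subset ha)

/-- `U_a` is divergence free. [folklore] -/
theorem isDivFree_tinyProfileAt (ha : a ≠ 0) : VectorCalculus.IsDivFree (tinyProfileAt R a) := by
  intro y
  show VectorCalculus.divergence (fun z => R.Y 0 • tinyBlob a z) y = 0
  rw [divergence_const_smul_apply ((differentiable_tinyBlob a) y), isDivFree_tinyBlob ha y, mul_zero]

/-- `‖U_a(y)‖ = Y₀(R) ‖B_a(y)‖`. [folklore] -/
theorem norm_tinyProfileAt (R : TowerRates) (a : ℝ) (y : EuclideanSpace ℝ (Fin 3)) :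
    ‖tinyProfileAt R a y‖ = R.Y 0 * ‖tinyBlob a y‖ := by
  rw [tinyProfileAt, norm_smul, Real.norm_eq_abs, abs_of_pos (R.Y_pos 0)]

/-- Ceiling `‖U_a‖ ≤ Y₀(R)`. [folklore] -/
theorem norm_tinyProfileAt_le (ha : a ≠ 0) (y : EuclideanSpace ℝ (Fin 3)) : ‖tinyProfileAt R a y‖ ≤ R.Y 0 := by
  rw [norm_tinyProfileAt]
  have hY := R.Y_pos 0
  nlinarith [norm_tinyBlob_le_one ha y]

/-- `U_a(0) = Y₀(R) e₃` and `‖U_a(0)‖ = Y₀(R)`. [folklore] -/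
theorem tinyProfileAt_zero (R : TowerRates) (a : ℝ) :
    tinyProfileAt R a 0 = R.Y 0 • e₃ ∧ ‖tinyProfileAt R a 0‖ = R.Y 0 := by
  refine ⟨by rw [tinyProfileAt, tinyBlob_zero], ?_⟩
  rw [norm_tinyProfileAt, norm_tinyBlob_zero, mul_one]

/-- The speed maximum is attained only at the centre. [folklore] -/
theorem eq_zero_of_norm_tinyProfileAt_eq (ha : a ≠ 0) {y : EuclideanSpace ℝ (Fin 3)}
    (hy : ‖tinyProfileAt R a y‖ = R.Y 0) : y = 0 := by
  rw [norm_tinyProfileAt] at hy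
  have hY := R.Y_pos 0
  have h1 : ‖tinyBlob a y‖ = 1 := mul_left_cancel₀ hY.ne' (hy.trans (mul_one _).symm)
  exact (norm_tinyBlob_eq_one_iff ha).1 h1

/-- `U_a` is even, flat at the centre (`DU_a(0) = 0`, `ΔU_a(0) = 0`). [folklore] -/
theorem tinyProfileAt_even_flat (R : TowerRates) (a : ℝ) :
    IsEvenAbout 0 (tinyProfileAt R a) ∧ fderiv ℝ (tinyProfileAt R a) 0 = 0 ∧ (Δ (tinyProfileAt R a)) 0 = 0 := by
  refine ⟨fun x => ?_, ?_, ?_⟩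
  · show tinyProfileAt R a (0 + (0 - x)) = tinyProfileAt R a x
    rw [zero_add, zero_sub, tinyProfileAt, tinyProfileAt, tinyBlob_neg]
  · have : fderiv ℝ (tinyProfileAt R a) 0 = R.Y 0 • fderiv ℝ (tinyBlob a) 0 := by
      show fderiv ℝ (fun z => R.Y 0 • tinyBlob a z) 0 = _
      rw [fderiv_fun_const_smul ((differentiable_tinyBlob a) 0)]
    rw [this, fderiv_tinyBlob_zero]
    ext v i
    simp
  · have hfun : tinyProfileAt R a = R.Y 0 • tinyBlob a := rfl
    have h2 : ContDiffAt ℝ 2 (tinyBlob a) 0 := ((contDiff_tinyBlob a).of_le (by norm_cast)).contDiffAt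
    rw [hfun, laplacian_smul _ h2, laplacian_tinyBlob_zero, smul_zero]

/-- **The strain floor at `R`**: `A₀(R) ≤ ‖DU_a(a y₁)‖` once `a ≤ strainConst/N₀(R)`. [folklore] -/
theorem strain_tinyProfileAt (ha : 0 < a) (hκ : a ≤ strainConst / R.N 0) :
    R.A 0 ≤ ‖fderiv ℝ (tinyProfileAt R a) (a • strainPt)‖ := by
  have hD : fderiv ℝ (tinyProfileAt R a) (a • strainPt) = R.Y 0 • fderiv ℝ (tinyBlob a) (a • strainPt) := by
    show fderiv ℝ (fun z => R.Y 0 • tinyBlob a z) (a • strainPt) = _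
    rw [fderiv_fun_const_smul ((differentiable_tinyBlob a) _)]
  rw [hD, norm_smul, Real.norm_eq_abs, abs_of_pos (R.Y_pos 0), norm_fderiv_tinyBlob_strainPt ha,
    A_zero_eq_N_mul_Y, mul_comm]
  have hY := R.Y_pos 0
  have hN := R.N_pos 0
  rw [mul_le_mul_iff_of_pos_left hY, le_div_iff₀ ha]
  rw [le_div_iff₀ hN] at hκ
  linarith

/-- **The winding number at `R`**: `m = ⌈3/(N₀ a)⌉`. [folklore] -/
def windingsAt (R : TowerRates) (a : ℝ) : ℕ := ⌈3 / (R.N 0 * a)⌉₊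

/-- `0 < m`, `3/N₀ ≤ a m ≤ 3/N₀ + a`. [folklore] -/
theorem windingsAt_spec (ha : 0 < a) :
    0 < windingsAt R a ∧ 3 / R.N 0 ≤ a * windingsAt R a ∧ a * windingsAt R a ≤ 3 / R.N 0 + a := by
  have hN := R.N_pos 0
  refine ⟨Nat.ceil_pos.2 (by positivity), ?_, ?_⟩
  · have h := Nat.le_ceil (3 / (R.N 0 * a))
    rw [windingsAt]
    rw [div_le_iff₀ (by positivity)] at h
    rw [div_le_iff₀ hN]
    nlinarith
  · have h := (Nat.ceil_lt_add_one (by positivity : (0 : ℝ) ≤ 3 / (R.N 0 * a))).le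
    rw [windingsAt]
    calc a * (⌈3 / (R.N 0 * a)⌉₊ : ℝ) ≤ a * (3 / (R.N 0 * a) + 1) := mul_le_mul_of_nonneg_left h ha.le
      _ = 3 / R.N 0 + a := by field_simp

/-- **The core loop at `R`** (`a ≤ 5/N₀(R)`): inside a `1/N₀`-ball centred in `B̄(0, 2a)`, speed `≤ 8π/N₀`,
circulation `≥ N₀^{β−2}`. [folklore] -/
theorem core_tinyProfileAt (ha : 0 < a) (h5 : a ≤ 5 / R.N 0) :
    ∃ (x : EuclideanSpace ℝ (Fin 3)) (γ : ℝ → EuclideanSpace ℝ (Fin 3)),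
      ‖x‖ ≤ 2 * a ∧ ContDiff ℝ 1 γ ∧ γ 0 = γ 1 ∧
        (∀ s ∈ Icc (0 : ℝ) 1, γ s ∈ closedBall x (1 / R.N 0)) ∧
        (∀ s ∈ Icc (0 : ℝ) 1, ‖deriv γ s‖ ≤ 8 * Real.pi / R.N 0) ∧
        R.N 0 ^ (R.β - 2) ≤ circulation (tinyProfileAt R a) γ := by
  obtain ⟨hm, hm1, hm2⟩ := windingsAt_spec (R := R) ha
  have hN := R.N_pos 0
  have h5' : a * R.N 0 ≤ 5 := by rwa [le_div_iff₀ hN] at h5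
  refine ⟨(a * lc) • TinyBlob.e₁, tinyLoop a (windingsAt R a), ?_, contDiff_tinyLoop _ _,
    tinyLoop_zero_eq_one _ _, fun s _ => ?_, fun s _ => ?_, ?_⟩
  · rw [norm_center ha.le, lc]; linarith
  · rw [mem_closedBall, dist_eq_norm, norm_tinyLoop_sub_center ha.le, lr, le_div_iff₀ hN]
    nlinarith
  · rw [deriv_tinyLoop, norm_tinyLoopVel ha.le, lr]
    have hπ := Real.pi_pos
    have e1 : 2 * π * (windingsAt R a : ℝ) * (a * (1 / 5)) = (2 * π / 5) * (a * windingsAt R a) := by ring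
    rw [e1, le_div_iff₀ hN]
    have h3 : (3 / R.N 0 + a) * R.N 0 = 3 + a * R.N 0 := by field_simp
    have h4 : a * (windingsAt R a : ℝ) * R.N 0 ≤ 3 + a * R.N 0 := by
      have := mul_le_mul_of_nonneg_right hm2 hN.le
      rwa [h3] at this
    nlinarith
  · rw [rpow_β_sub_two_eq]
    have hc := circulation_tinyBlob_tinyLoop_ge ha hm
    have hY := R.Y_pos 0
    have hU : tinyProfileAt R a = fun y => R.Y 0 • tinyBlob a y := rfl
    rw [hU, circulation_const_smul, div_eq_mul_one_div]
    refine mul_le_mul_of_nonneg_left ?_ hY.le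
    have h6 : 1 / R.N 0 ≤ 7 / 20 * (a * windingsAt R a) := by
      rw [div_le_iff₀ hN]
      have := mul_le_mul_of_nonneg_right hm1 hN.le
      rw [div_mul_cancel₀ _ hN.ne'] at this
      nlinarith
    exact h6.trans hc

/-! ## §2 The pusher at the rates `R`: `faintPusher (λ Y₀(R)/Y₀(wide))` -/

/-- The scale `μ = λ Y₀(R)/Y₀(wide)` is positive for `λ > 0` and `‖faintPusher μ‖ ≤ |λ| (15/32) Y₀(R)`.
[folklore] -/
theorem norm_faintPusher_scaled_le (R : TowerRates) (lam : ℝ) (x : EuclideanSpace ℝ (Fin 3)) :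
    ‖faintPusher (lam * (R.Y 0 / TowerRates.wide.Y 0)) x‖ ≤ |lam| * (15 / 32 * R.Y 0) := by
  rw [norm_faintPusher, abs_mul, abs_of_pos (div_pos (R.Y_pos 0) Host.wide_Y_zero_pos), mul_assoc]
  refine mul_le_mul_of_nonneg_left ?_ (abs_nonneg _)
  have h := norm_farPusher_le x
  have hw := Host.wide_Y_zero_pos
  calc R.Y 0 / TowerRates.wide.Y 0 * ‖farPusher x‖
      ≤ R.Y 0 / TowerRates.wide.Y 0 * (15 / 32 * TowerRates.wide.Y 0) :=
        mul_le_mul_of_nonneg_left h (div_pos (R.Y_pos 0) hw).le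
    _ = 15 / 32 * R.Y 0 := by field_simp

/-- `‖faintPusher μ‖ < Y₀(R)` for `|λ| ≤ 1`. [folklore] -/
theorem norm_faintPusher_scaled_lt (hlam : |lam| ≤ 1) (x : EuclideanSpace ℝ (Fin 3)) :
    ‖faintPusher (lam * (R.Y 0 / TowerRates.wide.Y 0)) x‖ < R.Y 0 := by
  have h := norm_faintPusher_scaled_le R lam x
  have hY := R.Y_pos 0
  have : |lam| * (15 / 32 * R.Y 0) ≤ 1 * (15 / 32 * R.Y 0) :=
    mul_le_mul_of_nonneg_right hlam (by positivity)
  linarith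

/-- The pusher is orthogonal to `Y₀(R) e₃`; the support lies in the forward cone of `Y₀(R) e₃` seen from `0`
(`⟪0 − y, Y₀(R) e₃⟫ ≤ 0` on `tsupport ψ`, `< 0` at the strict point). [folklore] -/
theorem faintPusher_forward (R : TowerRates) (μ : ℝ) :
    (∀ y, ⟪faintPusher μ y, R.Y 0 • e₃⟫ = 0) ∧
      (∀ y ∈ tsupport pusherPot, ⟪(0 : EuclideanSpace ℝ (Fin 3)) - y, R.Y 0 • e₃⟫ ≤ 0) ∧
      ⟪(0 : EuclideanSpace ℝ (Fin 3)) - strictPt, R.Y 0 • e₃⟫ < 0 := by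
  have hY := R.Y_pos 0
  refine ⟨fun y => ?_, fun y hy => ?_, ?_⟩
  · rw [faintPusher_apply, real_inner_smul_left, real_inner_smul_right, inner_farPusher_e₃, mul_zero, mul_zero]
  · obtain ⟨-, h2, -⟩ := geometry_of_mem_tsupport hy
    rw [zero_sub, inner_neg_left, real_inner_smul_right]
    nlinarith
  · rw [zero_sub, inner_neg_left, real_inner_smul_right, inner_strictPt_e₃]
    nlinarith

/-! ## §3 The tame carrier at the rates `R` and the strict slot -/

/-- **THE TAME CARRIER AT THE RATES `R`**: `tinyProfileAt R a + faintPusher (λ Y₀(R)/Y₀(wide))`. [folklore] -/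
def tameCarrierAt (R : TowerRates) (a lam : ℝ) : EuclideanSpace ℝ (Fin 3) → EuclideanSpace ℝ (Fin 3) :=
  tinyProfileAt R a + faintPusher (lam * (R.Y 0 / TowerRates.wide.Y 0))

/-- Near the origin (`‖x‖ < 15/4`) the carrier is the blob; far (`‖x‖ > 1`, `a ≤ 1/2`) it is the pusher.
[folklore] -/
theorem tameCarrierAt_near_far (ha : 0 < a) (ha2 : a ≤ 1 / 2) :
    (∀ x : EuclideanSpace ℝ (Fin 3), ‖x‖ < 15 / 4 → tameCarrierAt R a lam x = tinyProfileAt R a x) ∧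
      ∀ x : EuclideanSpace ℝ (Fin 3), 1 < ‖x‖ →
        tameCarrierAt R a lam x = faintPusher (lam * (R.Y 0 / TowerRates.wide.Y 0)) x := by
  refine ⟨fun x hx => ?_, fun x hx => ?_⟩
  · show tinyProfileAt R a x + faintPusher _ x = _
    rw [faintPusher_eq_zero_of_norm_lt hx, add_zero]
  · show tinyProfileAt R a x + faintPusher _ x = _
    rw [tinyProfileAt_eq_zero_of_norm_gt ha (by linarith), zero_add]

/-- **Speed ceiling and argmax**: `‖U x‖ ≤ Y₀(R)`, with equality only at `x = 0` (`|λ| ≤ 1`, `a ≤ 1/2`).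
[folklore] -/
theorem norm_tameCarrierAt_le (ha : 0 < a) (ha2 : a ≤ 1 / 2) (hlam : |lam| ≤ 1) :
    (∀ x, ‖tameCarrierAt R a lam x‖ ≤ R.Y 0) ∧
      ∀ x, ‖tameCarrierAt R a lam x‖ = R.Y 0 → x = 0 := by
  obtain ⟨hnear, hfar⟩ := tameCarrierAt_near_far (R := R) (lam := lam) ha ha2
  refine ⟨fun x => ?_, fun x hx => ?_⟩
  · by_cases h : ‖x‖ < 15 / 4
    · rw [hnear x h]; exact norm_tinyProfileAt_le ha.ne' x
    · push Not at h
      rw [hfar x (by linarith)]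
      exact (norm_faintPusher_scaled_lt hlam x).le
  · by_cases h : ‖x‖ < 15 / 4
    · rw [hnear x h] at hx; exact eq_zero_of_norm_tinyProfileAt_eq ha.ne' hx
    · push Not at h
      rw [hfar x (by linarith)] at hx
      exact absurd hx (norm_faintPusher_scaled_lt hlam x).ne

/-- **THE STRICT ANCHOR TEST AT EVERY VISCOSITY** for `λ ≠ 0`, `|λ| ≤ 1`, `a ≤ 1/2`. [cite: MajdaBertozziCUP2002, §1.8 Prop. 1.16] -/
theorem anchor_tameCarrierAt (ha : 0 < a) (ha2 : a ≤ 1 / 2) (hlam0 : lam ≠ 0) (hlam : |lam| ≤ 1) (ν : ℝ)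
    (x : EuclideanSpace ℝ (Fin 3)) (hx : ‖tameCarrierAt R a lam x‖ = R.Y 0) :
    0 < ⟪tameCarrierAt R a lam x, accel ν (tameCarrierAt R a lam) x⟫ := by
  obtain rfl := (norm_tameCarrierAt_le ha ha2 hlam).2 x hx
  set μ : ℝ := lam * (R.Y 0 / TowerRates.wide.Y 0) with hμ
  have hμ0 : μ ≠ 0 := mul_ne_zero hlam0 (div_pos (R.Y_pos 0) Host.wide_Y_zero_pos).ne'
  obtain ⟨heven, -, hflat⟩ := tinyProfileAt_even_flat R a
  obtain ⟨hperp', hfwd', hfwd₁'⟩ := faintPusher_forward R μ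
  have h0 : tinyProfileAt R a 0 = R.Y 0 • e₃ := (tinyProfileAt_zero R a).1
  have hfar : ∀ y ∈ tsupport (faintPusher μ), (1 : ℝ) < ‖(0 : EuclideanSpace ℝ (Fin 3)) - y‖ :=
    fun y hy => by
      rw [zero_sub, norm_neg]
      linarith [(geometry_of_mem_tsupport (tsupport_faintPusher_subset μ hy)).2.2]
  have hperp : ∀ y, ⟪faintPusher μ y, tinyProfileAt R a 0⟫ = 0 := fun y => by rw [h0]; exact hperp' y
  have hfwd : ∀ y ∈ tsupport (faintPusher μ),
      ⟪(0 : EuclideanSpace ℝ (Fin 3)) - y, tinyProfileAt R a 0⟫ ≤ 0 :=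
    fun y hy => by rw [h0]; exact hfwd' y (tsupport_faintPusher_subset μ hy)
  have hfwd₁ : ⟪(0 : EuclideanSpace ℝ (Fin 3)) - strictPt, tinyProfileAt R a 0⟫ < 0 := by rw [h0]; exact hfwd₁'
  have hdisj : Disjoint (tsupport (tinyProfileAt R a)) (tsupport (faintPusher μ)) := by
    refine Set.disjoint_left.2 fun x hx hx' => ?_
    have h1 : ‖x‖ ≤ 2 * a := by
      have := tsupport_tinyProfileAt_subset ha hx
      rwa [mem_closedBall, dist_zero_right] at this
    have h2 := (geometry_of_mem_tsupport (tsupport_faintPusher_subset μ hx')).2.2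
    linarith
  exact inner_accel_pos_of_flat_forward (contDiff_tinyProfileAt R a) (hasCompactSupport_tinyProfileAt ha)
    (isDivFree_tinyProfileAt ha.ne') heven hflat (contDiff_faintPusher μ) (hasCompactSupport_faintPusher μ)
    (isDivFree_faintPusher μ) hdisj one_pos hfar hperp hfwd
    (fun y hy => cone_faintPusher μ (tsupport_faintPusher_subset μ hy)) hfwd₁
    (cone_faintPusher_strictPt hμ0)

/-- `U` is smooth, divergence free, `tsupport U ⊆ B̄(0, 7)` (`a ≤ 1/2`). [folklore] -/
theorem tameCarrierAt_static (ha : 0 < a) (ha2 : a ≤ 1 / 2) (lam : ℝ) :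
    ContDiff ℝ ∞ (tameCarrierAt R a lam) ∧ VectorCalculus.IsDivFree (tameCarrierAt R a lam) ∧
      tsupport (tameCarrierAt R a lam) ⊆ closedBall (0 : EuclideanSpace ℝ (Fin 3)) 7 := by
  refine ⟨(contDiff_tinyProfileAt R a).add (contDiff_faintPusher _), ?_, ?_⟩
  · intro x
    have h1 := isDivFree_tinyProfileAt (R := R) ha.ne' x
    have h2 := isDivFree_faintPusher (lam * (R.Y 0 / TowerRates.wide.Y 0)) x
    simp only [VectorCalculus.divergence] at h1 h2 ⊢
    rw [tameCarrierAt, fderiv_add ((contDiff_tinyProfileAt R a).differentiable (by simp) x)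
      ((contDiff_faintPusher _).differentiable (by simp) x)]
    push_cast
    rw [map_add, h1, h2, add_zero]
  · refine closure_minimal (fun x hx => ?_) isClosed_closedBall
    rw [mem_closedBall, dist_zero_right]
    by_contra hfar
    push Not at hfar
    refine hx ?_
    rw [(tameCarrierAt_near_far ha ha2).2 x (by linarith)]
    refine faintPusher_eq_zero fun hmem => ?_
    have h1 := (geometry_of_mem_tsupport hmem).1
    have : ‖x‖ ≤ ‖x - pusherCenter‖ + ‖pusherCenter‖ := norm_le_norm_sub_add x pusherCenter
    rw [norm_pusherCenter] at this
    linarith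

/-- **THE TAME CARRIER FILLS THE STRICT SLOT AT THE RATES `R`**: `LevelZeroDataAt R (tameCarrierAt R a λ) 7`
for `0 < a ≤ 5/256`, `a ≤ 5/N₀(R)`, `a ≤ strainConst/N₀(R)`, `0 < λ ≤ 1`. [cite: Palasek2026ElementaryModel, §3.3] -/
theorem levelZeroDataAt_tameCarrierAt (ha : 0 < a) (h5 : a ≤ 5 / 256) (h5N : a ≤ 5 / R.N 0)
    (hκ : a ≤ strainConst / R.N 0) (hlam : 0 < lam) (hlam1 : lam ≤ 1) :
    LevelZeroDataAt R (tameCarrierAt R a lam) 7 := by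
  have ha2 : a ≤ 1 / 2 := h5.trans (by norm_num)
  have habs : |lam| ≤ 1 := by rw [abs_of_pos hlam]; exact hlam1
  obtain ⟨hsm, hdiv, hsupp⟩ := tameCarrierAt_static (R := R) ha ha2 lam
  obtain ⟨hnear, -⟩ := tameCarrierAt_near_far (R := R) (lam := lam) ha ha2
  have hopen : IsOpen {y : EuclideanSpace ℝ (Fin 3) | ‖y‖ < 15 / 4} := isOpen_lt continuous_norm continuous_const
  have hfd : ∀ x : EuclideanSpace ℝ (Fin 3), ‖x‖ < 15 / 4 →
      fderiv ℝ (tameCarrierAt R a lam) x = fderiv ℝ (tinyProfileAt R a) x := fun x hx => by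
    have hev : tameCarrierAt R a lam =ᶠ[𝓝 x] tinyProfileAt R a := by
      filter_upwards [hopen.mem_nhds hx] with y hy
      exact hnear y hy
    exact hev.fderiv_eq
  refine { smooth := hsm, support := hsupp, divFree := hdiv, ceiling := (norm_tameCarrierAt_le ha ha2 habs).1,
           floor := ⟨0, by simp, ?_⟩, strain := ?_, core := ?_,
           anchor := anchor_tameCarrierAt ha ha2 hlam.ne' habs 1 }
  · rw [hnear 0 (by simp), (tinyProfileAt_zero R a).2]
  · have hn : ‖a • strainPt‖ ≤ 2 * a := by
      rw [norm_smul, Real.norm_eq_abs, abs_of_pos ha]; nlinarith [norm_strainPt_le]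
    refine ⟨a • strainPt, by linarith, ?_⟩
    rw [hfd _ (by linarith)]
    exact strain_tinyProfileAt ha hκ
  · obtain ⟨x, γ, hx, hγ, h01, hball, hvel, hcirc⟩ := core_tinyProfileAt (R := R) ha h5N
    refine ⟨x, γ, by linarith, hγ, h01, hball, hvel, ?_⟩
    have hc : circulation (tameCarrierAt R a lam) γ = circulation (tinyProfileAt R a) γ := by
      unfold circulation
      refine intervalIntegral.integral_congr fun s hs => ?_
      rw [uIcc_of_le zero_le_one] at hs
      have hs' : ‖γ s‖ < 15 / 4 := by
        have hb := hball s hs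
        rw [mem_closedBall, dist_eq_norm] at hb
        have h1N : 1 / R.N 0 ≤ 1 := by
          rw [div_le_one (R.N_pos 0)]; exact (R.one_lt_N 0).le
        have : ‖γ s‖ ≤ ‖γ s - x‖ + ‖x‖ := norm_le_norm_sub_add (γ s) x
        linarith
      simp only [hnear _ hs']
    rw [hc]
    exact hcirc

end Summit.NavierStokesRegularity.FluidComputer.PalasekTowerClayBridge.Germ

end
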